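import Literature.NumberTheory.LFunctions.NicolasLemma24RH
import Literature.NumberTheory.LFunctions.RobinAnalyticSharp
import HarnessLib

/-!
# Robin's analytic bound for `P ≥ 4¹¹` from the Riemann hypothesis alone (no named facts)

Topic: `Literature/NumberTheory/LFunctions`. Provefact `Literature.NumberTheory.LFunctions.robin_iff`:
the analytic step of Robin's theorem at colossally abundant numbers with largest prime `P ≥ 4¹¹`,
`(∏_{p≤P}(1 − 1/p))⁻¹ · ∏_{Q<p≤P}(1 − 1/p²) < e^γ log(θ(P) + θ(Q))` (`mertens_prod_lt_RH`), now from the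
Riemann hypothesis ALONE — i.e. without the named facts `Nicolas2012_logf_lower_sharp` (Nicolas's (2.18))
and `PlattTrudgian2016_theta_lt` (`θ(y) < y`, `y ≤ 1.39·10¹⁷`) through which `RobinAnalyticSharp.lean` and
`PsiThetaSmall.lean` obtained it. The input is `Lemma24RH.logf_lowerRH` (`NicolasLemma24RH.lean`):
Nicolas's (2.18) proved from RH with Lemma 2.4 weakened to `ψ − θ ≤ 1.021√t + (4/3)t^{1/3}`, which shifts
the second-order error `E(x)` of (2.18) to

  `E_RH(x) = E(x) + 0.042/(√x log x) − 0.042/(√x log² x) + 0.168/(√x log³ x)` (`nicolasERH`),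

`−E_RH(x) ≤ log f(x)` for `x ≥ 599` (`neg_log_nicolasF_le_nicolasERH`, `prod_le_RH`). Robin's argument
(`RobinAnalyticSharp.lean`: `E(P) < G₂ + G₁` on cells, by a kernel-checked rational certificate) absorbs
the shift as follows.

* `nicolasERH_mul_le` — `E_RH(P)·√P log P ≤ eBox(b, L₁, U₁, L₂, s₁, p16 + 0.0224)` under the hypotheses
  of `nicolasE_mul_le` (the extra terms give `0.042 − 0.042/L + 0.168/L² ≤ 0.0448 = 2·0.0224` for
  `L ≥ 8`, and `eBox` contains `2 p16`): the shift is a bump of the parameter `p16` by `0.0224`.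
* `cell_keyRH`, `small_Q_keyRH`, `large_Q_keyRH` — the three combination lemmas of
  `RobinAnalyticSharp.lean` verbatim, with the box value at `p16 + 0.0224` (`G2_mul_ge`, `G1_mul_ge` reused).
* `Cells.Cell.checkRH`, `checkFirstRH`, `checkTailRH`, `coverOKRH` — the original Boolean checks AND the
  box inequality at `p16 + bump` (`bump = 0.0224`); `Cell.soundRH`, `soundFirstRH`, `tail_soundRH`,
  `cover_keyRH` — their soundness (the original proofs verbatim); `cover11RH_ok`, …, `cover17RH_ok` —
  **the same 700 cells of `RobinAnalyticSharp.lean` pass the bumped check** (`decide +kernel`; the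
  worst slack `0.095` at `k = 11` exceeds `0.0448`); `key_ineq_sharpRH` — `E_RH(P) < G₂ + G₁` for
  `4¹¹ ≤ P < 4¹⁸`.
* `nicolasERH_mul_lt_large` — for `P ≥ 2·10¹⁰`, `E_RH(P)·√P log P < 2.1422`
  (`= 2.1002 + 0.042`; the negative term `−(2.042 − β)/log P` dominates the decaying positive ones,
  `antitone_bounds_2e10` via `log_pow_div_rpow_le`), and `key_ineq_largeRH` — the proof of
  `RobinAnalytic.key_ineq` with `2.1422 < 2√(0.9747·1.19) = 2.154` in place of `2.1002`.
* `mertens_prod_lt_RH (hRH) (hP : 4¹¹ ≤ P) (hQP : Q ≤ P)` — the main estimate, the proof of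
  `mertens_prod_lt_sharp` with `E_RH`, `Schoenfeld1976_theta_holds` and the two key inequalities.

The sibling `RHClassicalEquivalentsRobinProofs.lean` concludes `robin_iff_holds` and `lagarias_iff_holds`.
Computational dependencies: the certified `2000` zeros of `ζ` behind `Schoenfeld1976_theta_holds`
(`native_decide`), and kernel computations (`decide +kernel`) of the tree.

## References

* G. Robin, *Grandes valeurs de la fonction somme des diviseurs et hypothèse de Riemann*, J. Math.
  Pures Appl. 63 (1984), 187–213, §3 (proof of Thm. 1). [Robin1984]
* J.-L. Nicolas, *Small values of the Euler function and the Riemann hypothesis*, Acta Arith. 155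
  (2012), 311–321 (arXiv:1202.0729): Lemma 2.4, (2.18), Prop. 2.1. [Nicolas2012]
* L. Schoenfeld, Math. Comp. 30 (1976), 337–360, §6 (6.3). [Schoenfeld1976]
-/

noncomputable section

open Real Filter Finset
open scoped Chebyshev

namespace Literature.NumberTheory.LFunctions

namespace RobinAnalyticSharp

/-! ### The modified second-order error `E_RH(x)` -/

/-- `E_RH(x) = E(x) + 0.042/(√x log x) − 0.042/(√x log² x) + 0.168/(√x log³ x)`: minus the left-hand
side of `Lemma24RH.logf_lowerRH` (Nicolas's (2.18) with Lemma 2.4 weakened to `1.021√t + (4/3)t^{1/3}`),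
so that `−E_RH(x) ≤ log f(x)` for `x ≥ 599` under RH (`neg_log_nicolasF_le_nicolasERH`).
[cite: Nicolas2012, (2.18) (proof of Prop. 2.1) (modified constants)] -/
def nicolasERH (x : ℝ) : ℝ :=
  nicolasE x + 0.042 / (√x * Real.log x) - 0.042 / (√x * Real.log x ^ 2) + 0.168 / (√x * Real.log x ^ 3)

/-- Under RH, `−log f(x) ≤ E_RH(x)` for `x ≥ 599` (`Lemma24RH.logf_lowerRH`). [cite: Nicolas2012, (2.18)] -/
theorem neg_log_nicolasF_le_nicolasERH (hRH : RiemannHypothesis) {x : ℝ} (hx : 599 ≤ x) :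
    -Real.log (nicolasF x) ≤ nicolasERH x := by
  have h := Lemma24RH.logf_lowerRH hRH hx
  have e : nicolasERH x = -(-(nicolasBeta + 2.042) / (√x * Real.log x)
      + (2.042 - nicolasBeta) / (√x * Real.log x ^ 2)
      - (8.168 + 4 * nicolasBeta) / (√x * Real.log x ^ 3) - Real.log (2 * π) / (x * Real.log x)
      - 2 / (x ^ ((2 : ℝ) / 3) * Real.log x) - Real.log x ^ 3 / (64 * π ^ 2 * x)) := by
    unfold nicolasERH nicolasE; ring
  rw [e]; linarith

/-- **Box bound for `E_RH`**: `E_RH(P)·√P log P ≤ eBox(b, L₁, U₁, L₂, s₁, p16 + 0.0224)` under the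
hypotheses of `nicolasE_mul_le` (the three extra terms contribute `0.042 − 0.042/L + 0.168/L² ≤ 0.0448`
for `L ≥ 8`, and `eBox` contains `2·p16`). [cite: Nicolas2012, (2.18) (proof of Prop. 2.1)] -/
theorem nicolasERH_mul_le {P P₁ P₂ b L₁ U₁ L₂ s₁ p16 : ℝ} (hb : nicolasBeta ≤ b) (hb2 : b ≤ 2)
    (hP₁ : 599 ≤ P₁) (hPl : P₁ ≤ P) (hPu : P ≤ P₂) (hL₁ : L₁ ≤ Real.log P₁) (hU₁ : Real.log P₁ ≤ U₁)
    (hL₂ : Real.log P₂ ≤ L₂) (hL₁8 : 8 ≤ L₁) (hs₁ : s₁ ≤ √P₁) (hs₁0 : 0 < s₁) (hp16 : 0 < p16)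
    (hp16' : 1 ≤ p16 ^ 6 * P₁) :
    nicolasERH P * (√P * Real.log P) ≤ eBox b L₁ U₁ L₂ s₁ (p16 + 0.0224) := by
  have hE := nicolasE_mul_le hb hb2 hP₁ hPl hPu hL₁ hU₁ hL₂ hL₁8 hs₁ hs₁0 hp16 hp16'
  have hP0 : 0 < P := by linarith
  have hP₁0 : 0 < P₁ := by linarith
  set L := Real.log P with hL
  set s := √P with hs
  have hs0 : 0 < s := Real.sqrt_pos.2 hP0
  have hLl : L₁ ≤ L := hL₁.trans (Real.log_le_log hP₁0 hPl)
  have hL8 : 8 ≤ L := hL₁8.trans hLl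
  have hL0 : 0 < L := by linarith
  have eX : (0.042 / (s * L) - 0.042 / (s * L ^ 2) + 0.168 / (s * L ^ 3)) * (s * L) =
      0.042 - 0.042 / L + 0.168 / L ^ 2 := by
    field_simp
  have h1 : 0.168 / L ^ 2 ≤ 0.168 / 64 := by
    apply div_le_div_of_nonneg_left (by norm_num) (by norm_num); nlinarith
  have h2 : 0 ≤ 0.042 / L := by positivity
  have eB : eBox b L₁ U₁ L₂ s₁ (p16 + 0.0224) = eBox b L₁ U₁ L₂ s₁ p16 + 2 * 0.0224 := by
    unfold eBox; ring
  have eE : nicolasERH P * (s * L) = nicolasE P * (s * L) +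
      (0.042 / (s * L) - 0.042 / (s * L ^ 2) + 0.168 / (s * L ^ 3)) * (s * L) := by
    unfold nicolasERH; ring
  rw [eE, eX, eB]
  linarith only [hE, h1, h2]

/-! ### The three combination lemmas with `E_RH` (verbatim from `cell_key`, `small_Q_key`, `large_Q_key`,
with the box value taken at `p16 + 0.0224`) -/

/-- `cell_key` for `E_RH`. [cite: Robin1984, §3 (proof of Thm. 1); Nicolas2012, (2.18)] -/
theorem cell_keyRH (hS : Schoenfeld1976_theta) (hRH : RiemannHypothesis) {P Q : ℕ}
    {P₁ P₂ b a₁ a₂ d₁ dP ℓ₁ L₁ U₁ L₂ s₁ p16 mlow cR : ℝ}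
    (hb : nicolasBeta ≤ b) (hb2 : b ≤ 2)
    (hQ : 599 ≤ Q) (hQP : Q ≤ P) (hP₁ : 599 ≤ P₁) (hPl : P₁ ≤ P) (hPu : (P : ℝ) ≤ P₂)
    (ha₁ : a₁ * √(P : ℝ) ≤ Q) (ha₂ : (Q : ℝ) ≤ a₂ * √(P : ℝ)) (ha₁0 : 0 ≤ a₁) (ha₂0 : 0 < a₂)
    (hd₁ : schoenfeldDelta (max 599 (a₁ * √P₁)) ≤ d₁) (hd₁1 : d₁ ≤ 1 / 2)
    (hdP : schoenfeldDelta P₁ ≤ dP)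
    (hℓ₁ : ℓ₁ ≤ Real.log (max 599 (a₁ * √P₁))) (hℓ₁0 : 0 < ℓ₁)
    (hL₁ : L₁ ≤ Real.log P₁) (hU₁ : Real.log P₁ ≤ U₁) (hL₂ : Real.log P₂ ≤ L₂) (hL₁8 : 8 ≤ L₁)
    (hs₁ : s₁ ≤ √P₁) (hs₁0 : 0 < s₁) (hp16 : 0 < p16) (hp16' : 1 ≤ p16 ^ 6 * P₁)
    (hm0 : 0 ≤ mlow) (hm : ∀ L : ℝ, L₁ ≤ L → mlow * (a₂ * (Real.log a₂ + L / 2)) ≤ L)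
    (hcR : (1 + dP) + (1 + d₁) * a₂ / s₁ ≤ cR)
    (hκ : 0 ≤ (1 - d₁) * (ℓ₁ / (ℓ₁ + 1)) - 2 * d₁)
    (hcell : eBox b L₁ U₁ L₂ s₁ (p16 + 0.0224) < g1Box d₁ a₁ cR L₁ + g2Box d₁ ℓ₁ mlow s₁) :
    nicolasERH P <
      ∑ p ∈ (Nat.primesLE P).filter (fun p => Q < p), ((p : ℝ) ^ 2)⁻¹ +
        θ Q / ((θ P + θ Q) * Real.log (θ P + θ Q)) := by
  have hP599 : (599 : ℝ) ≤ P := by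
    have : (599 : ℝ) ≤ Q := by exact_mod_cast hQ
    exact this.trans (by exact_mod_cast hQP)
  have hP0 : (0 : ℝ) < P := by linarith
  have hsL : 0 < √(P : ℝ) * Real.log P :=
    mul_pos (Real.sqrt_pos.2 hP0) (Real.log_pos (by linarith))
  have hE := nicolasERH_mul_le (P := (P : ℝ)) hb hb2 hP₁ hPl hPu hL₁ hU₁ hL₂ hL₁8 hs₁ hs₁0 hp16 hp16'
  have hG2 := G2_mul_ge hS hRH hQ hQP hPl hP₁ ha₁ ha₂ ha₁0 ha₂0 hd₁ hd₁1 hℓ₁ hℓ₁0 hL₁ hs₁ hs₁0 hm0 hm hκ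
  have hG1 := G1_mul_ge hS hRH hQ hQP hPl hP₁ ha₁ ha₂ ha₁0 ha₂0 hd₁ hd₁1 hdP hL₁ (by linarith)
    hs₁ hs₁0 hcR
  have h : nicolasERH P * (√(P : ℝ) * Real.log P) <
      (∑ p ∈ (Nat.primesLE P).filter (fun p => Q < p), ((p : ℝ) ^ 2)⁻¹ +
        θ Q / ((θ P + θ Q) * Real.log (θ P + θ Q))) * (√(P : ℝ) * Real.log P) := by
    rw [add_mul]; linarith
  exact lt_of_mul_lt_mul_right h hsL.le


/-- `small_Q_key` for `E_RH`. [cite: Robin1984, §3 (proof of Thm. 1)] -/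
theorem small_Q_keyRH (hS : Schoenfeld1976_theta) (hRH : RiemannHypothesis) {P Q : ℕ}
    {P₁ P₂ b a₂ d₁ ℓ₁ L₁ U₁ L₂ s₁ p16 mlow : ℝ}
    (hb : nicolasBeta ≤ b) (hb2 : b ≤ 2)
    (hQ : Q ≤ 599) (h599P : 599 ≤ P) (hP₁ : 599 ≤ P₁) (hPl : P₁ ≤ P) (hPu : (P : ℝ) ≤ P₂)
    (ha₂ : (599 : ℝ) ≤ a₂ * √(P : ℝ)) (ha₂0 : 0 < a₂)
    (hd₁ : schoenfeldDelta 599 ≤ d₁) (hd₁1 : d₁ ≤ 1 / 2)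
    (hℓ₁ : ℓ₁ ≤ Real.log 599) (hℓ₁0 : 0 < ℓ₁)
    (hL₁ : L₁ ≤ Real.log P₁) (hU₁ : Real.log P₁ ≤ U₁) (hL₂ : Real.log P₂ ≤ L₂) (hL₁8 : 8 ≤ L₁)
    (hs₁ : s₁ ≤ √P₁) (hs₁0 : 0 < s₁) (hp16 : 0 < p16) (hp16' : 1 ≤ p16 ^ 6 * P₁)
    (hm0 : 0 ≤ mlow) (hm : ∀ L : ℝ, L₁ ≤ L → mlow * (a₂ * (Real.log a₂ + L / 2)) ≤ L)
    (hκ : 0 ≤ (1 - d₁) * (ℓ₁ / (ℓ₁ + 1)) - 2 * d₁)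
    (hcell : eBox b L₁ U₁ L₂ s₁ (p16 + 0.0224) < g2Box d₁ ℓ₁ mlow s₁) :
    nicolasERH P <
      ∑ p ∈ (Nat.primesLE P).filter (fun p => Q < p), ((p : ℝ) ^ 2)⁻¹ +
        θ Q / ((θ P + θ Q) * Real.log (θ P + θ Q)) := by
  have hP599 : (599 : ℝ) ≤ P := by exact_mod_cast h599P
  have hP0 : (0 : ℝ) < P := by linarith
  have hsL : 0 < √(P : ℝ) * Real.log P :=
    mul_pos (Real.sqrt_pos.2 hP0) (Real.log_pos (by linarith))
  have hE := nicolasERH_mul_le (P := (P : ℝ)) hb hb2 hP₁ hPl hPu hL₁ hU₁ hL₂ hL₁8 hs₁ hs₁0 hp16 hp16'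
  -- the cell `[0, a₂]` at `Q' = 599`
  have hmax : max (599 : ℝ) (0 * √P₁) = 599 := by simp
  have hG2 := G2_mul_ge hS hRH (Q := 599) (P := P) le_rfl h599P hPl hP₁ (a₁ := 0) (a₂ := a₂)
    (by simp) (by exact_mod_cast ha₂) le_rfl ha₂0 (by rwa [hmax]) hd₁1 (by rwa [hmax]) hℓ₁0 hL₁ hs₁ hs₁0
    hm0 hm hκ
  have hS' := sum_filter_antitone (P := P) hQ
  have hG0 : 0 ≤ θ Q / ((θ P + θ Q) * Real.log (θ P + θ Q)) := by
    have h1 : 0 ≤ θ (Q : ℝ) := Chebyshev.theta_nonneg _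
    have h2 : 1 ≤ θ (P : ℝ) := by
      obtain ⟨hl, -⟩ := theta_two_sided hS hRH hP599 le_rfl
      have hδ := schoenfeldDelta_le hP599
      have : (1 - 0.0666) * 599 ≤ (1 - schoenfeldDelta P) * (P : ℝ) :=
        mul_le_mul (by linarith) hP599 (by norm_num) (by linarith [schoenfeldDelta_nonneg (P : ℝ)])
      linarith
    have h3 : 0 ≤ Real.log (θ P + θ Q) := Real.log_nonneg (by linarith)
    positivity
  have h : nicolasERH P * (√(P : ℝ) * Real.log P) <
      (∑ p ∈ (Nat.primesLE P).filter (fun p => 599 < p), ((p : ℝ) ^ 2)⁻¹) * (√(P : ℝ) * Real.log P) := by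
    linarith
  have h' := lt_of_mul_lt_mul_right h hsL.le
  linarith


/-- `large_Q_key` for `E_RH`. [cite: Robin1984, §3 (proof of Thm. 1)] -/
theorem large_Q_keyRH (hS : Schoenfeld1976_theta) (hRH : RiemannHypothesis) {P Q : ℕ}
    {P₁ P₂ b a d₁ dP L₁ U₁ L₂ s₁ p16 c : ℝ}
    (hb : nicolasBeta ≤ b) (hb2 : b ≤ 2)
    (hQ : 599 ≤ Q) (hQP : Q ≤ P) (hP₁ : 599 ≤ P₁) (hPl : P₁ ≤ P) (hPu : (P : ℝ) ≤ P₂)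
    (ha : a * √(P : ℝ) ≤ Q) (ha0 : 0 ≤ a)
    (hd₁ : schoenfeldDelta (max 599 (a * √P₁)) ≤ d₁) (hd₁1 : d₁ ≤ 1 / 2)
    (hdP : schoenfeldDelta P₁ ≤ dP)
    (hL₁ : L₁ ≤ Real.log P₁) (hU₁ : Real.log P₁ ≤ U₁) (hL₂ : Real.log P₂ ≤ L₂) (hL₁8 : 8 ≤ L₁)
    (hs₁ : s₁ ≤ √P₁) (hs₁0 : 0 < s₁) (hp16 : 0 < p16) (hp16' : 1 ≤ p16 ^ 6 * P₁)
    (hc : 2 + dP + d₁ ≤ c)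
    (hcell : eBox b L₁ U₁ L₂ s₁ (p16 + 0.0224) < (1 - d₁) * a / (c * (1 + (c - 1) / L₁))) :
    nicolasERH P <
      ∑ p ∈ (Nat.primesLE P).filter (fun p => Q < p), ((p : ℝ) ^ 2)⁻¹ +
        θ Q / ((θ P + θ Q) * Real.log (θ P + θ Q)) := by
  have hQr : (599 : ℝ) ≤ Q := by exact_mod_cast hQ
  have hQPr : (Q : ℝ) ≤ P := by exact_mod_cast hQP
  have hP599 : (599 : ℝ) ≤ P := hQr.trans hQPr
  have hP0 : (0 : ℝ) < P := by linarith
  have hP₁0 : 0 < P₁ := by linarith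
  have hQ0 : (0 : ℝ) < Q := by linarith
  set L := Real.log (P : ℝ) with hL
  set s := √(P : ℝ) with hs
  have hs0 : 0 < s := Real.sqrt_pos.2 hP0
  have hss : s * s = P := Real.mul_self_sqrt hP0.le
  have hLpos : 0 < L := Real.log_pos (by linarith)
  have hLl : L₁ ≤ L := hL₁.trans (Real.log_le_log hP₁0 hPl)
  have hL₁0 : 0 < L₁ := by linarith
  have hsL : 0 < s * L := mul_pos hs0 hLpos
  have hE := nicolasERH_mul_le (P := (P : ℝ)) hb hb2 hP₁ hPl hPu hL₁ hU₁ hL₂ hL₁8 hs₁ hs₁0 hp16 hp16'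
  have hS0 : 0 ≤ ∑ p ∈ (Nat.primesLE P).filter (fun p => Q < p), ((p : ℝ) ^ 2)⁻¹ :=
    Finset.sum_nonneg fun p _ => by positivity
  -- θ bounds and `G₁ ≥ (1−δQ)Q/(R₁ log R₁)`
  set δQ := schoenfeldDelta Q with hδQ
  set δP := schoenfeldDelta P with hδP
  obtain ⟨hθQl, hθQu⟩ := theta_two_sided hS hRH hQr le_rfl
  obtain ⟨hθPl, hθPu⟩ := theta_two_sided hS hRH hP599 le_rfl
  rw [← hδQ] at hθQl hθQu
  rw [← hδP] at hθPl hθPu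
  have hmaxQ : max 599 (a * √P₁) ≤ Q := by
    refine max_le hQr (le_trans ?_ ha)
    exact mul_le_mul_of_nonneg_left (Real.sqrt_le_sqrt hPl) ha0
  have hδQd : δQ ≤ d₁ := (schoenfeldDelta_antitone (le_max_left _ _) hmaxQ).trans hd₁
  have hδQ0 : 0 ≤ δQ := schoenfeldDelta_nonneg _
  have hδPd : δP ≤ dP := (schoenfeldDelta_antitone hP₁ hPl).trans hdP
  have hδP0 : 0 ≤ δP := schoenfeldDelta_nonneg _
  have hδP1 : δP ≤ 0.0666 := schoenfeldDelta_le hP599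
  have hd₁0 : 0 ≤ d₁ := hδQ0.trans hδQd
  set R₁ := (1 + δP) * P + (1 + δQ) * Q with hR₁
  have hθP1 : 1 ≤ θ P := by
    have : (1 - 0.0666) * 599 ≤ (1 - δP) * (P : ℝ) :=
      mul_le_mul (by linarith) hP599 (by norm_num) (by linarith)
    linarith
  have hlow : 0 ≤ (1 - δQ) * Q := mul_nonneg (by linarith) hQ0.le
  have hG := G1_lower hθP1 (Chebyshev.theta_nonneg _) hθQl hlow (by linarith : θ P + θ Q ≤ R₁)
  -- `R₁ ≤ c P`, `R₁ log R₁ ≤ cP (L + c − 1)`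
  have hc1 : 2 ≤ c := by linarith
  have hR₁le : R₁ ≤ c * P := by
    have h1 : (1 + δQ) * (Q : ℝ) ≤ (1 + d₁) * P := mul_le_mul (by linarith) hQPr hQ0.le (by linarith)
    have h2 : (1 + δP) * (P : ℝ) ≤ (1 + dP) * P := mul_le_mul_of_nonneg_right (by linarith) hP0.le
    have h3 : (1 + dP) * (P : ℝ) + (1 + d₁) * P ≤ c * P := by nlinarith
    simp only [hR₁]; linarith
  have hPδ : (P : ℝ) ≤ (1 + δP) * P := by
    have := mul_nonneg hδP0 hP0.le
    linarith [show (1 + δP) * (P : ℝ) = P + δP * P by ring]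
  have hQδ : 0 ≤ (1 + δQ) * (Q : ℝ) := by positivity
  have hR₁1 : 1 < R₁ := by simp only [hR₁]; linarith
  have hden0 : 0 < R₁ * Real.log R₁ := mul_pos (by linarith) (Real.log_pos hR₁1)
  have hlogR : R₁ * Real.log R₁ ≤ (c * P) * (L + (c - 1)) := by
    have h1 := mul_log_mono hR₁1.le hR₁le
    have h2 : Real.log (c * P) ≤ L + (c - 1) := by
      rw [Real.log_mul (by positivity) hP0.ne']
      linarith [Real.log_le_sub_one_of_pos (by positivity : 0 < c)]
    exact h1.trans (mul_le_mul_of_nonneg_left h2 (by positivity))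
  have hnum : (1 - d₁) * (a * s) ≤ (1 - δQ) * Q := mul_le_mul (by linarith) ha (by positivity) (by linarith)
  have hG2 : (1 - d₁) * (a * s) / ((c * P) * (L + (c - 1))) ≤ (1 - δQ) * Q / (R₁ * Real.log R₁) := by
    calc (1 - d₁) * (a * s) / ((c * P) * (L + (c - 1)))
        ≤ (1 - d₁) * (a * s) / (R₁ * Real.log R₁) :=
          div_le_div_of_nonneg_left (mul_nonneg (by linarith) (by positivity)) hden0 hlogR
      _ ≤ (1 - δQ) * Q / (R₁ * Real.log R₁) := div_le_div_of_nonneg_right hnum hden0.le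
  have e : (1 - d₁) * (a * s) / ((c * P) * (L + (c - 1))) * (s * L) =
      (1 - d₁) * a / (c * (1 + (c - 1) / L)) := by
    rw [← hss]; field_simp
  have hbox : (1 - d₁) * a / (c * (1 + (c - 1) / L₁)) ≤ (1 - d₁) * a / (c * (1 + (c - 1) / L)) := by
    apply div_le_div_of_nonneg_left (mul_nonneg (by linarith) ha0) (by
      have : 0 ≤ (c - 1) / L := by apply div_nonneg <;> linarith
      positivity)
    apply mul_le_mul_of_nonneg_left _ (by linarith)
    have : (c - 1) / L ≤ (c - 1) / L₁ := div_le_div_of_nonneg_left (by linarith) hL₁0 hLl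
    linarith
  have hG1 : (1 - d₁) * a / (c * (1 + (c - 1) / L₁)) ≤
      θ Q / ((θ P + θ Q) * Real.log (θ P + θ Q)) * (s * L) := by
    calc (1 - d₁) * a / (c * (1 + (c - 1) / L₁)) ≤ (1 - d₁) * a / (c * (1 + (c - 1) / L)) := hbox
      _ = (1 - d₁) * (a * s) / ((c * P) * (L + (c - 1))) * (s * L) := e.symm
      _ ≤ (1 - δQ) * Q / (R₁ * Real.log R₁) * (s * L) := mul_le_mul_of_nonneg_right hG2 hsL.le
      _ ≤ θ Q / ((θ P + θ Q) * Real.log (θ P + θ Q)) * (s * L) := mul_le_mul_of_nonneg_right hG hsL.le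
  have h : nicolasERH P * (s * L) <
      (∑ p ∈ (Nat.primesLE P).filter (fun p => Q < p), ((p : ℝ) ^ 2)⁻¹ +
        θ Q / ((θ P + θ Q) * Real.log (θ P + θ Q))) * (s * L) := by
    rw [add_mul]
    have : 0 ≤ (∑ p ∈ (Nat.primesLE P).filter (fun p => Q < p), ((p : ℝ) ^ 2)⁻¹) * (s * L) :=
      mul_nonneg hS0 hsL.le
    linarith
  exact lt_of_mul_lt_mul_right h hsL.le


/-! ### The cell checks with the bumped `p16` -/

namespace Cells

/-- The bump `0.0224` of `p16` absorbing the extra terms of `E_RH`. [folklore] -/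
def bump : ℚ := 224 / 10000

/-- Cell check for `E_RH`: the original check and the box inequality at `p16 + bump`. [folklore] -/
def Cell.checkRH (c : Cell) : Bool :=
  c.check && decide (eBoxQ c.k (c.p16 + bump) < c.g1BoxQ + c.g2BoxQ)

/-- First-cell check for `E_RH`. [folklore] -/
def Cell.checkFirstRH (c : Cell) : Bool :=
  c.checkFirst && decide (eBoxQ c.k (c.p16 + bump) < c.g2BoxQ)

/-- Tail check for `E_RH`. [folklore] -/
def checkTailRH (k : ℕ) (A : Anchor) (p16 : ℚ) : Bool :=
  checkTail k A p16 &&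
    decide (eBoxQ k (p16 + bump) < (1 - A.deltaU) * (A.n / 2 ^ k) /
        ((2 + dP k + A.deltaU) * (1 + ((2 + dP k + A.deltaU) - 1) / L1 k)))

/-- The full check of a `P`-range for `E_RH`. [folklore] -/
def coverOKRH (k : ℕ) (l : List Cell) (T : Anchor) (p16 : ℚ) : Bool :=
  match l with
  | [] => false
  | c₀ :: _ => c₀.checkFirstRH && decide (599 ≤ c₀.A₂.n) && decide (599 ≤ T.n)
      && l.all (fun c => c.checkRH && (c.k == k)) && chainOK l && (lastN l == T.n)
      && checkTailRH k T p16

/-- **Soundness of the cell check for `E_RH`** (the proof of `Cell.sound` verbatim, ending in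
`cell_keyRH` at `p16 + bump`). [cite: Robin1984, §3 (proof of Thm. 1); Nicolas2012, (2.18); Schoenfeld1976, §6] -/
theorem Cell.soundRH (hS : Schoenfeld1976_theta) (hRH : RiemannHypothesis) (c : Cell)
    (hc : c.checkRH = true) {P Q : ℕ} (hPl : 4 ^ c.k ≤ P) (hPu : P ≤ 4 ^ (c.k + 1))
    (hQ : 599 ≤ Q) (hQP : Q ≤ P)
    (hQ₁ : (c.A₁.n : ℝ) * √(P : ℝ) ≤ (Q : ℝ) * 2 ^ c.k)
    (hQ₂ : (Q : ℝ) * 2 ^ c.k ≤ (c.A₂.n : ℝ) * √(P : ℝ)) :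
    nicolasERH P <
      ∑ p ∈ (Nat.primesLE P).filter (fun p => Q < p), ((p : ℝ) ^ 2)⁻¹ +
        θ Q / ((θ P + θ Q) * Real.log (θ P + θ Q)) := by
  simp only [Cell.checkRH, Bool.and_eq_true, decide_eq_true_eq] at hc
  obtain ⟨hc, hcellRH⟩ := hc
  simp only [Cell.check, Bool.and_eq_true, Bool.or_eq_true, decide_eq_true_eq] at hc
  obtain ⟨⟨⟨⟨⟨⟨⟨⟨⟨⟨hA₁, hA₂⟩, hn⟩, hk⟩, hp0⟩, hp6⟩, hd1⟩, hell0⟩, hκ⟩, hla⟩, -⟩ := hc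
  obtain ⟨hP₁599, hL₁, hU₁, hL₂, hL₁8, hs₁, hs₁0⟩ := range_facts hk
  have hPl' : (4 : ℝ) ^ c.k ≤ P := by exact_mod_cast hPl
  have hPu' : (P : ℝ) ≤ (4 : ℝ) ^ (c.k + 1) := by exact_mod_cast hPu
  have h2k : (0 : ℝ) < 2 ^ c.k := by positivity
  have hP0 : (0 : ℝ) < P := lt_of_lt_of_le (by positivity) hPl'
  -- `a₁`, `a₂`
  have ha₁ : ((c.a1 : ℚ) : ℝ) * √(P : ℝ) ≤ Q := by
    simp only [Cell.a1]; push_cast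
    rw [div_mul_eq_mul_div, div_le_iff₀ h2k]; exact hQ₁
  have ha₂ : (Q : ℝ) ≤ ((c.a2 : ℚ) : ℝ) * √(P : ℝ) := by
    simp only [Cell.a2]; push_cast
    rw [div_mul_eq_mul_div, le_div_iff₀ h2k]; exact hQ₂
  have ha₁0 : (0 : ℝ) ≤ ((c.a1 : ℚ) : ℝ) := by simp only [Cell.a1]; push_cast; positivity
  have hn₂ : (1 : ℝ) ≤ c.A₂.n := by exact_mod_cast (Nat.succ_le_of_lt (lt_of_le_of_lt (Nat.zero_le _) hn))
  have ha₂0 : (0 : ℝ) < ((c.a2 : ℚ) : ℝ) := by simp only [Cell.a2]; push_cast; positivity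
  -- the anchor `a₁ √P₁ = n₁`
  have e₁ : ((c.a1 : ℚ) : ℝ) * √((4 : ℝ) ^ c.k) = c.A₁.n := by
    rw [sqrt_four_pow]; simp only [Cell.a1]; push_cast; field_simp
  have hd₁ : schoenfeldDelta (max 599 (((c.a1 : ℚ) : ℝ) * √((4 : ℝ) ^ c.k))) ≤ ((c.d1 : ℚ) : ℝ) := by
    rw [e₁]
    by_cases h : 599 ≤ c.A₁.n
    · have hv : c.A₁.valid = true := hA₁.resolve_left (not_lt.2 h)
      rw [max_eq_right (by exact_mod_cast h)]
      simp only [Cell.d1, if_pos h]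
      exact c.A₁.delta_le hv
    · push Not at h
      rw [max_eq_left (by exact_mod_cast h.le)]
      simp only [Cell.d1, if_neg (not_le.2 h), d599]
      have := schoenfeldDelta_599_le
      push_cast; linarith
  have hd₁1 : ((c.d1 : ℚ) : ℝ) ≤ 1 / 2 := by
    have h := (Rat.cast_le (K := ℝ)).2 hd1; push_cast at h; exact h
  have hdP : schoenfeldDelta ((4 : ℝ) ^ c.k) ≤ ((dP c.k : ℚ) : ℝ) := dP_sound c.k
  have hℓ₁ : ((c.ell1 : ℚ) : ℝ) ≤ Real.log (max 599 (((c.a1 : ℚ) : ℝ) * √((4 : ℝ) ^ c.k))) := by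
    rw [e₁]
    by_cases h : 599 ≤ c.A₁.n
    · have hv : c.A₁.valid = true := hA₁.resolve_left (not_lt.2 h)
      rw [max_eq_right (by exact_mod_cast h)]
      simp only [Cell.ell1, if_pos h]
      exact (c.A₁.log_bounds hv).1
    · push Not at h
      rw [max_eq_left (by exact_mod_cast h.le)]
      simp only [Cell.ell1, if_neg (not_le.2 h)]
      exact ell599_le
  have hℓ₁0 : (0 : ℝ) < ((c.ell1 : ℚ) : ℝ) := by exact_mod_cast hell0
  have hp16 : (0 : ℝ) < ((c.p16 : ℚ) : ℝ) := by exact_mod_cast hp0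
  have hp16' : (1 : ℝ) ≤ ((c.p16 : ℚ) : ℝ) ^ 6 * (4 : ℝ) ^ c.k := by exact_mod_cast hp6
  have hL₁0 : (0 : ℝ) < ((L1 c.k : ℚ) : ℝ) := by linarith
  -- `mlow`
  obtain ⟨hm0, hm⟩ := c.mlow_facts hA₂ hla hL₁0 ha₂0
  have hcR : (1 + ((dP c.k : ℚ) : ℝ)) + (1 + ((c.d1 : ℚ) : ℝ)) * ((c.a2 : ℚ) : ℝ) / ((s1 c.k : ℚ) : ℝ) ≤
      ((c.cR : ℚ) : ℝ) := by
    simp only [Cell.cR]; push_cast; exact le_rfl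
  have hκ' : (0 : ℝ) ≤ (1 - ((c.d1 : ℚ) : ℝ)) * (((c.ell1 : ℚ) : ℝ) / (((c.ell1 : ℚ) : ℝ) + 1)) -
      2 * ((c.d1 : ℚ) : ℝ) := by
    have : (0 : ℝ) ≤ ((c.kappa : ℚ) : ℝ) := by exact_mod_cast hκ
    simp only [Cell.kappa] at this; push_cast at this; exact this
  have ebump : (((c.p16 + bump : ℚ)) : ℝ) = ((c.p16 : ℚ) : ℝ) + 0.0224 := by
    push_cast [bump]; norm_num
  have hcell' : eBox ((bU : ℚ) : ℝ) (L1 c.k : ℝ) (U1 c.k : ℝ) (L2 c.k : ℝ) (s1 c.k : ℝ) ((c.p16 : ℝ) + 0.0224) <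
      g1Box (c.d1 : ℝ) (c.a1 : ℝ) (c.cR : ℝ) (L1 c.k : ℝ) + g2Box (c.d1 : ℝ) (c.ell1 : ℝ) (c.mlow : ℝ) (s1 c.k : ℝ) := by
    rw [← ebump, ← eBoxQ_cast, ← g1BoxQ_cast, ← g2BoxQ_cast]; exact_mod_cast hcellRH
  have hb : nicolasBeta ≤ ((bU : ℚ) : ℝ) := by
    have := nicolasBeta_lt; simp only [bU]; push_cast; linarith
  have hb2 : ((bU : ℚ) : ℝ) ≤ 2 := by simp only [bU]; push_cast; norm_num
  exact cell_keyRH hS hRH hb hb2 hQ hQP hP₁599 hPl' hPu' ha₁ ha₂ ha₁0 ha₂0 hd₁ hd₁1 hdP hℓ₁ hℓ₁0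
    hL₁ hU₁ hL₂ hL₁8 hs₁ hs₁0 hp16 hp16' hm0 hm hcR hκ' hcell'


/-- **Soundness of a first cell for `E_RH`.** [cite: Robin1984, §3 (proof of Thm. 1)] -/
theorem Cell.soundFirstRH (hS : Schoenfeld1976_theta) (hRH : RiemannHypothesis) (c : Cell)
    (hc : c.checkFirstRH = true) (hn₂ : 599 ≤ c.A₂.n) {P Q : ℕ} (hPl : 4 ^ c.k ≤ P)
    (hPu : P ≤ 4 ^ (c.k + 1)) (hQ : Q ≤ 599) :
    nicolasERH P <
      ∑ p ∈ (Nat.primesLE P).filter (fun p => Q < p), ((p : ℝ) ^ 2)⁻¹ +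
        θ Q / ((θ P + θ Q) * Real.log (θ P + θ Q)) := by
  simp only [Cell.checkFirstRH, Bool.and_eq_true, decide_eq_true_eq] at hc
  obtain ⟨hc, hcellRH⟩ := hc
  simp only [Cell.checkFirst, Cell.check, Bool.and_eq_true, Bool.or_eq_true, decide_eq_true_eq,
    beq_iff_eq] at hc
  obtain ⟨⟨⟨⟨⟨⟨⟨⟨⟨⟨⟨⟨hA₁, hA₂⟩, hn⟩, hk⟩, hp0⟩, hp6⟩, hd1⟩, hell0⟩, hκ⟩, hla⟩, -⟩, hzero⟩, -⟩ := hc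
  obtain ⟨hP₁599, hL₁, hU₁, hL₂, hL₁8, hs₁, hs₁0⟩ := range_facts hk
  have hPl' : (4 : ℝ) ^ c.k ≤ P := by exact_mod_cast hPl
  have hPu' : (P : ℝ) ≤ (4 : ℝ) ^ (c.k + 1) := by exact_mod_cast hPu
  have h2k : (0 : ℝ) < 2 ^ c.k := by positivity
  have h599P : 599 ≤ P := by
    have : (599 : ℝ) ≤ P := hP₁599.trans hPl'
    exact_mod_cast this
  have hn₂r : (599 : ℝ) ≤ c.A₂.n := by exact_mod_cast hn₂
  have ha₂0 : (0 : ℝ) < ((c.a2 : ℚ) : ℝ) := by simp only [Cell.a2]; push_cast; positivity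
  have ha₂ : (599 : ℝ) ≤ ((c.a2 : ℚ) : ℝ) * √(P : ℝ) := by
    simp only [Cell.a2]; push_cast
    have hsP : (2 : ℝ) ^ c.k ≤ √(P : ℝ) := by rw [← sqrt_four_pow]; exact Real.sqrt_le_sqrt hPl'
    rw [div_mul_eq_mul_div, le_div_iff₀ h2k]
    calc (599 : ℝ) * 2 ^ c.k ≤ c.A₂.n * 2 ^ c.k := by gcongr
      _ ≤ c.A₂.n * √(P : ℝ) := by gcongr
  have hlt : c.A₁.n < 599 := by rw [hzero]; norm_num
  have hd₁ : schoenfeldDelta 599 ≤ ((c.d1 : ℚ) : ℝ) := by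
    simp only [Cell.d1, if_neg (not_le.2 hlt), d599]
    have := schoenfeldDelta_599_le; push_cast; linarith
  have hd₁1 : ((c.d1 : ℚ) : ℝ) ≤ 1 / 2 := by
    have h := (Rat.cast_le (K := ℝ)).2 hd1; push_cast at h; exact h
  have hℓ₁ : ((c.ell1 : ℚ) : ℝ) ≤ Real.log 599 := by
    simp only [Cell.ell1, if_neg (not_le.2 hlt)]; exact ell599_le
  have hℓ₁0 : (0 : ℝ) < ((c.ell1 : ℚ) : ℝ) := by exact_mod_cast hell0
  have hp16 : (0 : ℝ) < ((c.p16 : ℚ) : ℝ) := by exact_mod_cast hp0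
  have hp16' : (1 : ℝ) ≤ ((c.p16 : ℚ) : ℝ) ^ 6 * (4 : ℝ) ^ c.k := by exact_mod_cast hp6
  have hL₁0 : (0 : ℝ) < ((L1 c.k : ℚ) : ℝ) := by linarith
  obtain ⟨hm0, hm⟩ := c.mlow_facts hA₂ hla hL₁0 ha₂0
  have hκ' : (0 : ℝ) ≤ (1 - ((c.d1 : ℚ) : ℝ)) * (((c.ell1 : ℚ) : ℝ) / (((c.ell1 : ℚ) : ℝ) + 1)) -
      2 * ((c.d1 : ℚ) : ℝ) := by
    have : (0 : ℝ) ≤ ((c.kappa : ℚ) : ℝ) := by exact_mod_cast hκ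
    simp only [Cell.kappa] at this; push_cast at this; exact this
  have ebump : (((c.p16 + bump : ℚ)) : ℝ) = ((c.p16 : ℚ) : ℝ) + 0.0224 := by
    push_cast [bump]; norm_num
  have hcell' : eBox ((bU : ℚ) : ℝ) (L1 c.k : ℝ) (U1 c.k : ℝ) (L2 c.k : ℝ) (s1 c.k : ℝ) ((c.p16 : ℝ) + 0.0224) <
      g2Box (c.d1 : ℝ) (c.ell1 : ℝ) (c.mlow : ℝ) (s1 c.k : ℝ) := by
    rw [← ebump, ← eBoxQ_cast, ← g2BoxQ_cast]; exact_mod_cast hcellRH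
  have hb : nicolasBeta ≤ ((bU : ℚ) : ℝ) := by
    have := nicolasBeta_lt; simp only [bU]; push_cast; linarith
  have hb2 : ((bU : ℚ) : ℝ) ≤ 2 := by simp only [bU]; push_cast; norm_num
  exact small_Q_keyRH hS hRH hb hb2 hQ h599P hP₁599 hPl' hPu' ha₂ ha₂0 hd₁ hd₁1 hℓ₁ hℓ₁0 hL₁ hU₁ hL₂
    hL₁8 hs₁ hs₁0 hp16 hp16' hm0 hm hκ' hcell'


/-- **Soundness of the tail check for `E_RH`.** [cite: Robin1984, §3 (proof of Thm. 1)] -/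
theorem tail_soundRH (hS : Schoenfeld1976_theta) (hRH : RiemannHypothesis) (k : ℕ) (A : Anchor)
    (p16 : ℚ) (h : checkTailRH k A p16 = true) (hn : 599 ≤ A.n) {P Q : ℕ} (hPl : 4 ^ k ≤ P)
    (hPu : P ≤ 4 ^ (k + 1)) (hQ : 599 ≤ Q) (hQP : Q ≤ P)
    (hQ₁ : (A.n : ℝ) * √(P : ℝ) ≤ (Q : ℝ) * 2 ^ k) :
    nicolasERH P <
      ∑ p ∈ (Nat.primesLE P).filter (fun p => Q < p), ((p : ℝ) ^ 2)⁻¹ +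
        θ Q / ((θ P + θ Q) * Real.log (θ P + θ Q)) := by
  simp only [checkTailRH, Bool.and_eq_true, decide_eq_true_eq] at h
  obtain ⟨h, hcellRH⟩ := h
  simp only [checkTail, Bool.and_eq_true, decide_eq_true_eq] at h
  obtain ⟨⟨⟨⟨⟨hA, hk⟩, hp0⟩, hp6⟩, hd1⟩, -⟩ := h
  obtain ⟨hP₁599, hL₁, hU₁, hL₂, hL₁8, hs₁, hs₁0⟩ := range_facts hk
  have hPl' : (4 : ℝ) ^ k ≤ P := by exact_mod_cast hPl
  have hPu' : (P : ℝ) ≤ (4 : ℝ) ^ (k + 1) := by exact_mod_cast hPu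
  have h2k : (0 : ℝ) < 2 ^ k := by positivity
  set a : ℝ := (A.n : ℝ) / 2 ^ k with ha_def
  have ha : a * √(P : ℝ) ≤ Q := by
    rw [ha_def, div_mul_eq_mul_div, div_le_iff₀ h2k]; exact hQ₁
  have ha0 : 0 ≤ a := by rw [ha_def]; positivity
  have e₁ : a * √((4 : ℝ) ^ k) = A.n := by rw [sqrt_four_pow, ha_def]; field_simp
  have hnr : (599 : ℝ) ≤ A.n := by exact_mod_cast hn
  have hd₁ : schoenfeldDelta (max 599 (a * √((4 : ℝ) ^ k))) ≤ ((A.deltaU : ℚ) : ℝ) := by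
    rw [e₁, max_eq_right hnr]; exact A.delta_le hA
  have hd₁1 : ((A.deltaU : ℚ) : ℝ) ≤ 1 / 2 := by
    have h := (Rat.cast_le (K := ℝ)).2 hd1; push_cast at h; exact h
  have hdP : schoenfeldDelta ((4 : ℝ) ^ k) ≤ ((dP k : ℚ) : ℝ) := dP_sound k
  have hp16 : (0 : ℝ) < ((p16 : ℚ) : ℝ) := by exact_mod_cast hp0
  have hp16' : (1 : ℝ) ≤ ((p16 : ℚ) : ℝ) ^ 6 * (4 : ℝ) ^ k := by exact_mod_cast hp6
  have hc : 2 + ((dP k : ℚ) : ℝ) + ((A.deltaU : ℚ) : ℝ) ≤ 2 + ((dP k : ℚ) : ℝ) + ((A.deltaU : ℚ) : ℝ) :=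
    le_rfl
  have ebump : (((p16 + bump : ℚ)) : ℝ) = ((p16 : ℚ) : ℝ) + 0.0224 := by
    push_cast [bump]; norm_num
  have hcell' : eBox ((bU : ℚ) : ℝ) (L1 k : ℝ) (U1 k : ℝ) (L2 k : ℝ) (s1 k : ℝ) ((p16 : ℝ) + 0.0224) <
      (1 - ((A.deltaU : ℚ) : ℝ)) * a / ((2 + ((dP k : ℚ) : ℝ) + ((A.deltaU : ℚ) : ℝ)) *
        (1 + ((2 + ((dP k : ℚ) : ℝ) + ((A.deltaU : ℚ) : ℝ)) - 1) / ((L1 k : ℚ) : ℝ))) := by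
    rw [← ebump, ← eBoxQ_cast, ha_def]
    have h := (Rat.cast_lt (K := ℝ)).2 hcellRH
    push_cast at h
    exact h
  have hb : nicolasBeta ≤ ((bU : ℚ) : ℝ) := by
    have := nicolasBeta_lt; simp only [bU]; push_cast; linarith
  have hb2 : ((bU : ℚ) : ℝ) ≤ 2 := by simp only [bU]; push_cast; norm_num
  exact large_Q_keyRH hS hRH hb hb2 hQ hQP hP₁599 hPl' hPu' ha ha0 hd₁ hd₁1 hdP hL₁ hU₁ hL₂ hL₁8 hs₁ hs₁0
    hp16 hp16' hc hcell'


/-- **The key inequality for `E_RH` on a `P`-range from a passing cover.**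
[cite: Robin1984, §3 (proof of Thm. 1); Nicolas2012, (2.18); Schoenfeld1976, §6] -/
theorem cover_keyRH (hS : Schoenfeld1976_theta) (hRH : RiemannHypothesis) {k : ℕ} {l : List Cell}
    {T : Anchor} {p16 : ℚ} (h : coverOKRH k l T p16 = true) {P Q : ℕ} (hPl : 4 ^ k ≤ P)
    (hPu : P ≤ 4 ^ (k + 1)) (hQP : Q ≤ P) :
    nicolasERH P <
      ∑ p ∈ (Nat.primesLE P).filter (fun p => Q < p), ((p : ℝ) ^ 2)⁻¹ +
        θ Q / ((θ P + θ Q) * Real.log (θ P + θ Q)) := by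
  match l, h with
  | c₀ :: t, h =>
    simp only [coverOKRH, Bool.and_eq_true, decide_eq_true_eq, beq_iff_eq, List.all_eq_true] at h
    obtain ⟨⟨⟨⟨⟨⟨hfirst, h599⟩, hT599⟩, hall⟩, hchain⟩, hlast⟩, htail⟩ := h
    have hk0 : c₀.k = k := (hall c₀ (by simp)).2
    have hPl' : (4 : ℝ) ^ k ≤ P := by exact_mod_cast hPl
    have hP0 : (0 : ℝ) < P := lt_of_lt_of_le (by positivity) hPl'
    have hsP : 0 < √(P : ℝ) := Real.sqrt_pos.2 hP0
    have h2k : (0 : ℝ) < 2 ^ k := by positivity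
    rcases le_or_gt Q 599 with hQ | hQ
    · -- small `Q`
      exact c₀.soundFirstRH hS hRH hfirst h599 (hk0 ▸ hPl) (hk0 ▸ hPu) hQ
    · have hQ' : 599 ≤ Q := hQ.le
      set x : ℝ := (Q : ℝ) * 2 ^ k / √(P : ℝ) with hx
      rcases le_or_gt (T.n : ℝ) x with hT | hT
      · -- the tail
        refine tail_soundRH hS hRH k T p16 htail hT599 hPl hPu hQ' hQP ?_
        rwa [hx, le_div_iff₀ hsP] at hT
      · -- a cell
        have hzero : c₀.A₁.n = 0 := by
          simp only [Cell.checkFirstRH, Cell.checkFirst, Bool.and_eq_true, beq_iff_eq,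
            decide_eq_true_eq] at hfirst
          exact hfirst.1.1.2
        have hx0 : (c₀.A₁.n : ℝ) ≤ x := by rw [hzero, Nat.cast_zero]; positivity
        have hxl : x ≤ lastN (c₀ :: t) := by rw [hlast]; exact hT.le
        obtain ⟨c, hc, hc1, hc2⟩ := exists_bracket t c₀ hchain x hx0 hxl
        obtain ⟨hcc, hck⟩ := hall c hc
        refine c.soundRH hS hRH hcc (hck ▸ hPl) (hck ▸ hPu) hQ' hQP ?_ ?_
        · rw [hck]; rwa [hx, le_div_iff₀ hsP] at hc1
        · rw [hck]; rwa [hx, div_le_iff₀ hsP] at hc2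



/-- The seven covers pass the bumped check (kernel evaluation; cell data of `RobinAnalyticSharp.lean`). [folklore] -/
theorem cover11RH_ok : coverOKRH 11 cover11 tail11 p16_11 = true := by decide +kernel
/-- See `cover11RH_ok`. [folklore] -/
theorem cover12RH_ok : coverOKRH 12 cover12 tail12 p16_12 = true := by decide +kernel
/-- See `cover11RH_ok`. [folklore] -/
theorem cover13RH_ok : coverOKRH 13 cover13 tail13 p16_13 = true := by decide +kernel
/-- See `cover11RH_ok`. [folklore] -/
theorem cover14RH_ok : coverOKRH 14 cover14 tail14 p16_14 = true := by decide +kernel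
/-- See `cover11RH_ok`. [folklore] -/
theorem cover15RH_ok : coverOKRH 15 cover15 tail15 p16_15 = true := by decide +kernel
/-- See `cover11RH_ok`. [folklore] -/
theorem cover16RH_ok : coverOKRH 16 cover16 tail16 p16_16 = true := by decide +kernel
/-- See `cover11RH_ok`. [folklore] -/
theorem cover17RH_ok : coverOKRH 17 cover17 tail17 p16_17 = true := by decide +kernel

end Cells

/-! ### `E_RH(P) < G₂ + G₁` for `4¹¹ ≤ P < 4¹⁸` (cells) and for `P ≥ 2·10¹⁰` -/

open Cells in
/-- **Key inequality for `E_RH`, `4¹¹ ≤ P < 4¹⁸`**, by the bumped cell covers.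
[cite: Robin1984, §3 (proof of Thm. 1); Nicolas2012, (2.18); Schoenfeld1976, §6] -/
theorem key_ineq_sharpRH (hRH : RiemannHypothesis) {P Q : ℕ}
    (hP : 4 ^ 11 ≤ P) (hP' : P < 4 ^ 18) (hQP : Q ≤ P) :
    nicolasERH P <
      ∑ p ∈ (Nat.primesLE P).filter (fun p => Q < p), ((p : ℝ) ^ 2)⁻¹ +
        θ Q / ((θ P + θ Q) * Real.log (θ P + θ Q)) := by
  have hS := Schoenfeld1976_theta_holds
  have hP0 : P ≠ 0 := by intro h; rw [h] at hP; norm_num at hP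
  have hk1 : 4 ^ Nat.log 4 P ≤ P := Nat.pow_log_le_self 4 hP0
  have hk2 : P < 4 ^ (Nat.log 4 P + 1) := Nat.lt_pow_succ_log_self (by norm_num) P
  have hk11 : 11 ≤ Nat.log 4 P := Nat.le_log_of_pow_le (by norm_num) hP
  have hk17 : Nat.log 4 P < 18 := Nat.log_lt_of_lt_pow hP0 hP'
  set k := Nat.log 4 P with hk
  interval_cases k
  · exact cover_keyRH hS hRH cover11RH_ok hk1 hk2.le hQP
  · exact cover_keyRH hS hRH cover12RH_ok hk1 hk2.le hQP
  · exact cover_keyRH hS hRH cover13RH_ok hk1 hk2.le hQP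
  · exact cover_keyRH hS hRH cover14RH_ok hk1 hk2.le hQP
  · exact cover_keyRH hS hRH cover15RH_ok hk1 hk2.le hQP
  · exact cover_keyRH hS hRH cover16RH_ok hk1 hk2.le hQP
  · exact cover_keyRH hS hRH cover17RH_ok hk1 hk2.le hQP

/-- `log(2·10¹⁰) ≤ 23.719`. [folklore] -/
theorem log_2e10_le : Real.log (2 * 10 ^ 10 : ℝ) ≤ 23.719 := by
  rw [Real.log_mul (by norm_num) (by norm_num), Real.log_pow]
  have := Real.log_two_lt_d9
  have := RobinAnalytic.log_ten_lt
  push_cast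
  linarith

/-- `(2·10¹⁰)^{1/6} ≥ 52.1` (`52.1⁶ < 2·10¹⁰`). [folklore] -/
theorem rpow_sixth_2e10_ge : (52.1 : ℝ) ≤ (2 * 10 ^ 10 : ℝ) ^ ((1 : ℝ) / 6) := by
  by_contra hlt
  rw [not_le] at hlt
  have h0 : (0 : ℝ) ≤ (2 * 10 ^ 10 : ℝ) ^ ((1 : ℝ) / 6) := by positivity
  have h6 := pow_lt_pow_left₀ hlt h0 (by norm_num : (6 : ℕ) ≠ 0)
  rw [← Real.rpow_mul_natCast (by norm_num)] at h6
  norm_num at h6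

/-- The three non-increasing quantities at `P ≥ 2·10¹⁰`: `log P/P^{1/6} ≤ 0.45527`,
`log P/√P ≤ 0.000168`, `log⁵ P/√P ≤ 53.1` (`NicolasMertensRH`'s `log_pow_div_rpow_le`). [folklore] -/
theorem antitone_bounds_2e10 {P : ℕ} (hP : (2 * 10 ^ 10 : ℝ) ≤ P) :
    Real.log P / (P : ℝ) ^ ((1 : ℝ) / 6) ≤ 0.45527 ∧ Real.log P / √(P : ℝ) ≤ 0.000168 ∧
      Real.log P ^ 5 / √(P : ℝ) ≤ 53.1 := by
  have hb0 : (0 : ℝ) < 2 * 10 ^ 10 := by norm_num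
  have hlog := log_2e10_le
  have hlog' := RobinAnalytic.log_2e10_gt
  have hl0 : 0 ≤ Real.log (2 * 10 ^ 10 : ℝ) := Real.log_nonneg (by norm_num)
  have hsq := RobinAnalytic.sqrt_2e10_ge
  have hb6 := rpow_sixth_2e10_ge
  refine ⟨?_, ?_, ?_⟩
  · have h := log_pow_div_rpow_le (a := 1 / 6) (by norm_num) (k := 1) le_rfl hb0
      (by norm_num; linarith) hP
    rw [pow_one, pow_one] at h
    calc Real.log P / (P : ℝ) ^ ((1 : ℝ) / 6)
        ≤ Real.log (2 * 10 ^ 10 : ℝ) / (2 * 10 ^ 10 : ℝ) ^ ((1 : ℝ) / 6) := h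
      _ ≤ 23.719 / 52.1 := div_le_div₀ (by norm_num) hlog (by norm_num) hb6
      _ ≤ 0.45527 := by norm_num
  · have h := log_pow_div_rpow_le (a := 1 / 2) (by norm_num) (k := 1) le_rfl hb0
      (by norm_num; linarith) hP
    rw [pow_one, pow_one, ← Real.sqrt_eq_rpow, ← Real.sqrt_eq_rpow] at h
    calc Real.log P / √(P : ℝ) ≤ Real.log (2 * 10 ^ 10 : ℝ) / √(2 * 10 ^ 10 : ℝ) := h
      _ ≤ 23.719 / 141421 := div_le_div₀ (by norm_num) hlog (by norm_num) hsq
      _ ≤ 0.000168 := by norm_num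
  · have h := log_pow_div_rpow_le (a := 1 / 2) (by norm_num) (k := 5) (by norm_num) hb0
      (by norm_num; linarith) hP
    rw [← Real.sqrt_eq_rpow, ← Real.sqrt_eq_rpow] at h
    have h5 : Real.log (2 * 10 ^ 10 : ℝ) ^ 5 ≤ 23.719 ^ 5 := pow_le_pow_left₀ hl0 hlog 5
    calc Real.log P ^ 5 / √(P : ℝ) ≤ Real.log (2 * 10 ^ 10 : ℝ) ^ 5 / √(2 * 10 ^ 10 : ℝ) := h
      _ ≤ 23.719 ^ 5 / 141421 := div_le_div₀ (by norm_num) h5 (by norm_num) hsq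
      _ ≤ 53.1 := by norm_num

/-- `E_RH(P)·√P log P` in closed form (`y = P^{1/6}`, `s = √P`, `L = log P`):
`(β+2) − (2−β)/L + (8+4β)/L² + log(2π)/s + 2/y + L⁴/s/(64π²) + 0.042 − 0.042/L + 0.168/L²`. [folklore] -/
theorem nicolasERH_mul_eq {P : ℝ} (hP : 1 < P) :
    nicolasERH P * (√P * Real.log P) =
      (nicolasBeta + 2) - (2 - nicolasBeta) / Real.log P + (8 + 4 * nicolasBeta) / Real.log P ^ 2 +
      Real.log (2 * π) / √P + 2 / P ^ ((1 : ℝ) / 6) + Real.log P ^ 4 / √P / (64 * π ^ 2) +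
      0.042 - 0.042 / Real.log P + 0.168 / Real.log P ^ 2 := by
  have hP0 : 0 < P := by linarith
  set L := Real.log P with hLdef
  set s := √P with hs
  have hs0 : 0 < s := Real.sqrt_pos.2 hP0
  have hss : s * s = P := Real.mul_self_sqrt hP0.le
  have hL0 : 0 < L := Real.log_pos hP
  have hπ := Real.pi_pos
  set y := P ^ ((1 : ℝ) / 6) with hy
  have hy0 : 0 < y := Real.rpow_pos_of_pos hP0 _
  have hy3 : y ^ 3 = s := by
    rw [hy, ← Real.rpow_mul_natCast hP0.le, hs, Real.sqrt_eq_rpow]; norm_num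
  have hy4 : y ^ 4 = P ^ ((2 : ℝ) / 3) := by
    rw [hy, ← Real.rpow_mul_natCast hP0.le]; norm_num
  unfold nicolasERH nicolasE
  rw [← hy4]
  have t1 : (nicolasBeta + 2) / (s * L) * (s * L) = nicolasBeta + 2 := by field_simp
  have t2 : (2 - nicolasBeta) / (s * L ^ 2) * (s * L) = (2 - nicolasBeta) / L := by field_simp
  have t3 : (8 + 4 * nicolasBeta) / (s * L ^ 3) * (s * L) = (8 + 4 * nicolasBeta) / L ^ 2 := by
    field_simp
  have t4 : Real.log (2 * π) / (P * L) * (s * L) = Real.log (2 * π) / s := by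
    rw [← hss]; field_simp
  have t5 : 2 / (y ^ 4 * L) * (s * L) = 2 / y := by
    rw [← hy3]; field_simp
  have t6 : L ^ 3 / (64 * π ^ 2 * P) * (s * L) = L ^ 4 / s / (64 * π ^ 2) := by
    rw [← hss]; field_simp
  have t7 : 0.042 / (s * L) * (s * L) = 0.042 := by field_simp
  have t8 : 0.042 / (s * L ^ 2) * (s * L) = 0.042 / L := by field_simp
  have t9 : 0.168 / (s * L ^ 3) * (s * L) = 0.168 / L ^ 2 := by field_simp
  have hdist : ((nicolasBeta + 2) / (s * L) - (2 - nicolasBeta) / (s * L ^ 2)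
      + (8 + 4 * nicolasBeta) / (s * L ^ 3) + Real.log (2 * π) / (P * L)
      + 2 / (y ^ 4 * L) + L ^ 3 / (64 * π ^ 2 * P) + 0.042 / (s * L) - 0.042 / (s * L ^ 2)
      + 0.168 / (s * L ^ 3)) * (s * L) =
      (nicolasBeta + 2) / (s * L) * (s * L) - (2 - nicolasBeta) / (s * L ^ 2) * (s * L)
      + (8 + 4 * nicolasBeta) / (s * L ^ 3) * (s * L) + Real.log (2 * π) / (P * L) * (s * L)
      + 2 / (y ^ 4 * L) * (s * L) + L ^ 3 / (64 * π ^ 2 * P) * (s * L)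
      + 0.042 / (s * L) * (s * L) - 0.042 / (s * L ^ 2) * (s * L) + 0.168 / (s * L ^ 3) * (s * L) := by
    ring
  rw [hdist, t1, t2, t3, t4, t5, t6, t7, t8, t9]

/-- **`E_RH(P)·√P log P < 2.1422` for `P ≥ 2·10¹⁰`**: with `L = log P`,
`E_RH·√P L ≤ 2.1002 + 0.042 − 1.9868/L + 8.3888/L² + 1.84/√P + 2P^{−1/6} + L⁴/(631.65 √P)` (`2 + β < 2.1002`,
`β < 0.0552`, `log 2π ≤ 1.84`, `π² ≥ 9.8696`), and
`L·(−1.9868/L + …) ≤ −1.9868 + 8.3888/L + 1.84 L/√P + 2L/P^{1/6} + L⁵/(631.65√P) ≤ −0.63 < 0`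
(`antitone_bounds_2e10`). [cite: Nicolas2012, (2.18) and Prop. 2.1 (method of (2.20))] -/
theorem nicolasERH_mul_lt_large {P : ℕ} (hP : (2 * 10 ^ 10 : ℝ) ≤ P) :
    nicolasERH P * (√(P : ℝ) * Real.log P) < 2.1422 := by
  have hL := RobinAnalytic.logP_ge hP
  have hsP := RobinAnalytic.sqrtP_ge hP
  have hP0 : (0 : ℝ) < P := lt_of_lt_of_le (by norm_num) hP
  have hP1 : (1 : ℝ) < P := lt_of_lt_of_le (by norm_num) hP
  obtain ⟨hA1, hA2, hA3⟩ := antitone_bounds_2e10 hP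
  rw [nicolasERH_mul_eq hP1]
  set L := Real.log (P : ℝ) with hLdef
  set s := √(P : ℝ) with hs
  set y := (P : ℝ) ^ ((1 : ℝ) / 6) with hy
  have hs0 : 0 < s := by linarith
  have hL0 : 0 < L := by linarith
  have hy0 : 0 < y := Real.rpow_pos_of_pos hP0 _
  have hβ := nicolasBeta_lt
  have hβ2 := RobinAnalytic.two_add_nicolasBeta_lt
  have h2π := log_two_pi_le
  have hπ2 := pi_sq_ge
  -- bounds of the individual terms
  have u2 : -((2 - nicolasBeta) / L) - 0.042 / L ≤ -(1.9868 / L) := by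
    have e : -(1.9868 / L) - (-((2 - nicolasBeta) / L) - 0.042 / L) =
        (2.042 - nicolasBeta - 1.9868) / L := by ring
    rw [← sub_nonneg, e]; exact div_nonneg (by linarith) hL0.le
  have u3 : (8 + 4 * nicolasBeta) / L ^ 2 + 0.168 / L ^ 2 ≤ 8.3888 / L ^ 2 := by
    rw [← add_div]; exact div_le_div_of_nonneg_right (by linarith) (by positivity)
  have u4 : Real.log (2 * π) / s ≤ 1.84 / s := div_le_div_of_nonneg_right h2π hs0.le
  have u6 : L ^ 4 / s / (64 * π ^ 2) ≤ L ^ 4 / (631.65 * s) := by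
    rw [div_div]
    apply div_le_div_of_nonneg_left (by positivity) (by positivity)
    nlinarith
  -- the decaying terms against `1.9868/L`, after multiplication by `L`
  have v1 : 8.3888 / L ^ 2 * L ≤ 0.3537 := by
    have e : 8.3888 / L ^ 2 * L = 8.3888 / L := by field_simp
    rw [e, div_le_iff₀ hL0]; nlinarith
  have v2 : 1.84 / s * L ≤ 0.00031 := by
    have e : 1.84 / s * L = 1.84 * (L / s) := by ring
    rw [e]; nlinarith
  have v3 : 2 / y * L ≤ 0.91054 := by
    have e : 2 / y * L = 2 * (L / y) := by ring
    rw [e]; nlinarith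
  have v4 : L ^ 4 / (631.65 * s) * L ≤ 0.0841 := by
    have e : L ^ 4 / (631.65 * s) * L = (L ^ 5 / s) / 631.65 := by field_simp
    rw [e, div_le_iff₀ (by norm_num)]; nlinarith
  have key : -(1.9868 / L) + 8.3888 / L ^ 2 + 1.84 / s + 2 / y + L ^ 4 / (631.65 * s) < 0 := by
    have hneg : (-(1.9868 / L) + 8.3888 / L ^ 2 + 1.84 / s + 2 / y + L ^ 4 / (631.65 * s)) * L < 0 := by
      have e : (-(1.9868 / L) + 8.3888 / L ^ 2 + 1.84 / s + 2 / y + L ^ 4 / (631.65 * s)) * L =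
          -1.9868 + 8.3888 / L ^ 2 * L + 1.84 / s * L + 2 / y * L + L ^ 4 / (631.65 * s) * L := by
        field_simp
      rw [e]; linarith only [v1, v2, v3, v4]
    by_contra hge
    rw [not_lt] at hge
    have := mul_nonneg hge hL0.le
    linarith only [this, hneg]
  linarith only [u2, u3, u4, u6, key, hβ2]

/-- **Key inequality for `E_RH`, `P ≥ 2·10¹⁰`** (the proof of `RobinAnalytic.key_ineq` with the
constant `2.1422 < 2√(0.9747·1.19) = 2.1540`). [cite: Robin1984, §3 (proof of Thm. 1); Schoenfeld1976, §6] -/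
theorem key_ineq_largeRH (hRH : RiemannHypothesis) {P Q : ℕ}
    (hP : (2 * 10 ^ 10 : ℝ) ≤ P) (hQP : Q ≤ P) :
    nicolasERH P <
      ∑ p ∈ (Nat.primesLE P).filter (fun p => Q < p), ((p : ℝ) ^ 2)⁻¹ +
        θ Q / ((θ P + θ Q) * Real.log (θ P + θ Q)) := by
  have hS := Schoenfeld1976_theta_holds
  have hL := RobinAnalytic.logP_ge hP
  have hsP := RobinAnalytic.sqrtP_ge hP
  have hsq := RobinAnalytic.sq_sqrtP hP
  have hP0 := RobinAnalytic.P_pos hP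
  obtain ⟨hθP1, hθP2⟩ := RobinAnalytic.thetaP_bounds hP hS hRH
  have hden : 0 < √(P : ℝ) * Real.log P := by positivity
  have hE : nicolasERH P < 2.1422 / (√(P : ℝ) * Real.log P) := by
    rw [lt_div_iff₀ hden]; exact nicolasERH_mul_lt_large hP
  refine hE.trans_le ?_
  set S := ∑ p ∈ (Nat.primesLE P).filter (fun p => Q < p), ((p : ℝ) ^ 2)⁻¹ with hSdef
  set G := θ Q / ((θ P + θ Q) * Real.log (θ P + θ Q)) with hGdef
  have hS0 : 0 ≤ S := Finset.sum_nonneg fun p _ => by positivity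
  have hG0 : 0 ≤ G := by
    have h1 : 0 ≤ θ Q := Chebyshev.theta_nonneg _
    have h2 : 1 < θ P + θ Q := by nlinarith
    have h3 : 0 < Real.log (θ P + θ Q) := Real.log_pos h2
    positivity
  rcases le_or_gt (5 * √(P : ℝ)) Q with hA | hA
  · have := RobinAnalytic.gain_caseA hS hRH hP hQP hA
    have h2 : 2.1422 / (√(P : ℝ) * Real.log P) ≤ 2.36 / (√(P : ℝ) * Real.log P) :=
      div_le_div_of_nonneg_right (by norm_num) hden.le
    linarith
  rcases le_or_gt (Q : ℝ) (√(P : ℝ) / 4) with hB | hB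
  · have := RobinAnalytic.window_caseB hS hRH hP hB
    have h2 : 2.1422 / (√(P : ℝ) * Real.log P) ≤ 5.8 / (√(P : ℝ) * Real.log P) :=
      div_le_div_of_nonneg_right (by norm_num) hden.le
    linarith
  · have h1 := RobinAnalytic.gain_caseC hS hRH hP hB hA
    have h2 := RobinAnalytic.window_caseC hS hRH hP hB hA
    have hQ0 : (0 : ℝ) < Q := by
      have : (0 : ℝ) < √(P : ℝ) / 4 := by positivity
      linarith
    have hLpos : 0 < Real.log P := by linarith
    have hs0 : 0 < √(P : ℝ) := by linarith
    have hquad : 0 ≤ 0.9747 * (Q : ℝ) ^ 2 - 2.1422 * Q * √(P : ℝ) + 1.19 * √(P : ℝ) ^ 2 := by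
      nlinarith [sq_nonneg ((Q : ℝ) - 1.0989 * √(P : ℝ)), hQ0.le, hs0.le, mul_nonneg hQ0.le hs0.le]
    have hid : (0.9747 * (Q : ℝ) ^ 2 + 1.19 * P) * √(P : ℝ) - 2.1422 * P * Q =
        √(P : ℝ) * (0.9747 * (Q : ℝ) ^ 2 - 2.1422 * Q * √(P : ℝ) + 1.19 * √(P : ℝ) ^ 2) := by
      linear_combination (2.1422 * (Q : ℝ) - 1.19 * √(P : ℝ)) * hsq
    have hnum : 2.1422 * (P : ℝ) * Q ≤ (0.9747 * (Q : ℝ) ^ 2 + 1.19 * P) * √(P : ℝ) := by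
      nlinarith [mul_nonneg hs0.le hquad]
    have key : 2.1422 / (√(P : ℝ) * Real.log P) ≤
        0.9747 * Q / ((P : ℝ) * Real.log P) + 1.19 / ((Q : ℝ) * Real.log P) := by
      have e1 : 0.9747 * Q / ((P : ℝ) * Real.log P) + 1.19 / ((Q : ℝ) * Real.log P) =
          (0.9747 * (Q : ℝ) ^ 2 + 1.19 * P) / ((P : ℝ) * Q * Real.log P) := by
        field_simp
      rw [e1, div_le_div_iff₀ (by positivity) (by positivity)]
      nlinarith [mul_le_mul_of_nonneg_right hnum hLpos.le]
    linarith

/-! ### The main estimate from RH alone -/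

/-- Product form of `neg_log_nicolasF_le_nicolasERH`: under RH, for `x ≥ 599`,
`(∏_{p ≤ x} (1 − 1/p))⁻¹ ≤ e^γ · log θ(x) · exp(E_RH(x))`. [cite: Nicolas2012, (2.18) (proof of Prop. 2.1)] -/
theorem prod_le_RH (hRH : RiemannHypothesis) {x : ℝ} (hx : 599 ≤ x) :
    (∏ p ∈ Nat.primesLE ⌊x⌋₊, (1 - (p : ℝ)⁻¹))⁻¹ ≤
      rexp eulerMascheroniConstant * Real.log (θ x) * rexp (nicolasERH x) := by
  have hx3 : (3 : ℝ) ≤ x := le_trans (by norm_num) hx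
  have hf : 0 < nicolasF x := nicolasF_pos hx3
  have hA : 0 < rexp eulerMascheroniConstant * Real.log (θ x) :=
    mul_pos (Real.exp_pos _) (Real.log_pos (one_lt_theta hx3))
  have h1 : -Real.log (nicolasF x) ≤ nicolasERH x := neg_log_nicolasF_le_nicolasERH hRH hx
  have h2 : (nicolasF x)⁻¹ ≤ rexp (nicolasERH x) := by
    have : (nicolasF x)⁻¹ = rexp (-Real.log (nicolasF x)) := by
      rw [Real.exp_neg, Real.exp_log hf]
    rw [this]
    exact Real.exp_le_exp.2 h1
  have h3 : (∏ p ∈ Nat.primesLE ⌊x⌋₊, (1 - (p : ℝ)⁻¹))⁻¹ =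
      rexp eulerMascheroniConstant * Real.log (θ x) * (nicolasF x)⁻¹ := by
    have hnf : nicolasF x = (rexp eulerMascheroniConstant * Real.log (θ x)) *
        ∏ p ∈ Nat.primesLE ⌊x⌋₊, (1 - (p : ℝ)⁻¹) := rfl
    rw [hnf, mul_inv, ← mul_assoc, mul_inv_cancel₀ hA.ne', one_mul]
  rw [h3]
  exact mul_le_mul_of_nonneg_left h2 hA.le

/-- **Main analytic estimate from RH alone, threshold `4¹¹`**: under RH, for naturals `Q ≤ P` with
`P ≥ 4¹¹`, `(∏_{p≤P}(1 − 1/p))⁻¹ · ∏_{Q<p≤P}(1 − 1/p²) < e^γ log(θ(P) + θ(Q))` — the proof of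
`mertens_prod_lt_sharp` with `E_RH` (`prod_le_RH`; `key_ineq_sharpRH` below `4¹⁸`,
`key_ineq_largeRH` from `2·10¹⁰`) and `Schoenfeld1976_theta_holds`; no named fact remains.
[cite: Robin1984, §3 (proof of Thm. 1); Nicolas2012, Prop. 2.1 and (2.18)] -/
theorem mertens_prod_lt_RH (hRH : RiemannHypothesis) {P Q : ℕ} (hP : 4 ^ 11 ≤ P) (hQP : Q ≤ P) :
    (∏ p ∈ Nat.primesLE P, (1 - (p : ℝ)⁻¹))⁻¹ *
        ∏ p ∈ (Nat.primesLE P).filter (fun p => Q < p), (1 - ((p : ℝ) ^ 2)⁻¹) <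
      rexp eulerMascheroniConstant * Real.log (θ P + θ Q) := by
  have hS := Schoenfeld1976_theta_holds
  have hPr : (4 : ℝ) ^ 11 ≤ P := by exact_mod_cast hP
  have hP599 : (599 : ℝ) ≤ P := le_trans (by norm_num) hPr
  have hP0 : (0 : ℝ) < P := by linarith
  -- (3) key inequality
  have h3 : nicolasERH P <
      ∑ p ∈ (Nat.primesLE P).filter (fun p => Q < p), ((p : ℝ) ^ 2)⁻¹ +
        θ Q / ((θ P + θ Q) * Real.log (θ P + θ Q)) := by
    by_cases hbig : (2 * 10 ^ 10 : ℝ) ≤ P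
    · exact key_ineq_largeRH hRH hbig hQP
    · rw [not_le] at hbig
      have hP18 : P < 4 ^ 18 := by
        have : (P : ℝ) < 4 ^ 18 := hbig.trans (by norm_num)
        exact_mod_cast this
      exact key_ineq_sharpRH hRH hP hP18 hQP
  -- θ bounds at `P`
  obtain ⟨hθPl, -⟩ := theta_two_sided hS hRH hP599 le_rfl
  have hδP := schoenfeldDelta_le hP599
  have hθP1 : 1 < θ P := by
    have : (1 - 0.0666) * 599 ≤ (1 - schoenfeldDelta P) * (P : ℝ) :=
      mul_le_mul (by linarith) hP599 (by norm_num) (by linarith [schoenfeldDelta_nonneg (P : ℝ)])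
    linarith
  set S := ∑ p ∈ (Nat.primesLE P).filter (fun p => Q < p), ((p : ℝ) ^ 2)⁻¹ with hSdef
  set R := θ P + θ Q with hR
  set A := Real.log (θ P) with hA
  set E := nicolasERH P with hE
  have hA0 : 0 < A := Real.log_pos hθP1
  have hθQ0 : 0 ≤ θ Q := Chebyshev.theta_nonneg _
  have hR1 : 1 < R := by linarith
  have hlogR0 : 0 < Real.log R := Real.log_pos hR1
  -- (1) `∏(1-1/p)⁻¹ ≤ e^γ · A · e^E`
  have h1 : (∏ p ∈ Nat.primesLE P, (1 - (p : ℝ)⁻¹))⁻¹ ≤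
      rexp eulerMascheroniConstant * A * rexp E := by
    have h := prod_le_RH hRH (x := (P : ℝ)) hP599
    rwa [Nat.floor_natCast] at h
  -- (2) `∏(1-1/p²) ≤ e^{-S}`
  have h2 : ∏ p ∈ (Nat.primesLE P).filter (fun p => Q < p), (1 - ((p : ℝ) ^ 2)⁻¹) ≤ rexp (-S) := by
    refine RobinAnalytic.prod_one_sub_le_exp_neg_sum _ _ fun p hp => ?_
    have hp' := Nat.prime_of_mem_primesLE (Finset.mem_filter.1 hp).1
    have : (1 : ℝ) ≤ (p : ℝ) ^ 2 := by
      have : (1 : ℝ) ≤ p := by exact_mod_cast hp'.one_lt.le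
      nlinarith
    exact inv_le_one_of_one_le₀ this
  have hPi0 : 0 ≤ ∏ p ∈ (Nat.primesLE P).filter (fun p => Q < p), (1 - ((p : ℝ) ^ 2)⁻¹) :=
    Finset.prod_nonneg fun p hp => by
      have hp' := Nat.prime_of_mem_primesLE (Finset.mem_filter.1 hp).1
      have : (1 : ℝ) ≤ (p : ℝ) ^ 2 := by
        have : (1 : ℝ) ≤ p := by exact_mod_cast hp'.one_lt.le
        nlinarith
      linarith [inv_le_one_of_one_le₀ this]
  have h4 : θ Q / (R * Real.log R) ≤ Real.log (Real.log R) - Real.log A := by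
    have hθPpos : 0 < θ P := by linarith
    have hRA : Real.log R - A = Real.log (R / θ P) := by
      rw [hA, Real.log_div (by linarith) hθPpos.ne']
    have h5 : θ Q / R ≤ Real.log R - A := by
      rw [hRA]
      have := Real.one_sub_inv_le_log_of_pos (x := R / θ P) (by positivity)
      have e1 : 1 - (R / θ P)⁻¹ = θ Q / R := by
        rw [hR]
        field_simp
        ring
      linarith
    have h6 : (Real.log R - A) / Real.log R ≤ Real.log (Real.log R) - Real.log A := by
      rw [← Real.log_div hlogR0.ne' hA0.ne']
      have := Real.one_sub_inv_le_log_of_pos (x := Real.log R / A) (by positivity)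
      have e1 : 1 - (Real.log R / A)⁻¹ = (Real.log R - A) / Real.log R := by
        field_simp
      linarith
    calc θ Q / (R * Real.log R) = θ Q / R / Real.log R := by rw [div_div]
      _ ≤ (Real.log R - A) / Real.log R := div_le_div_of_nonneg_right h5 hlogR0.le
      _ ≤ Real.log (Real.log R) - Real.log A := h6
  -- (5) `A · exp(E - S) < log R`
  have h7 : A * rexp (E - S) < Real.log R := by
    have h8 : E - S < Real.log (Real.log R) - Real.log A := by linarith [h3, h4]
    have h9 : rexp (E - S) < Real.log R / A := by
      calc rexp (E - S) < rexp (Real.log (Real.log R) - Real.log A) := Real.exp_lt_exp.2 h8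
        _ = Real.log R / A := by rw [Real.exp_sub, Real.exp_log hlogR0, Real.exp_log hA0]
    have := mul_lt_mul_of_pos_left h9 hA0
    rwa [mul_div_cancel₀ _ hA0.ne'] at this
  calc (∏ p ∈ Nat.primesLE P, (1 - (p : ℝ)⁻¹))⁻¹ *
        ∏ p ∈ (Nat.primesLE P).filter (fun p => Q < p), (1 - ((p : ℝ) ^ 2)⁻¹)
      ≤ (rexp eulerMascheroniConstant * A * rexp E) * rexp (-S) := by
        calc _ ≤ (rexp eulerMascheroniConstant * A * rexp E) *
              ∏ p ∈ (Nat.primesLE P).filter (fun p => Q < p), (1 - ((p : ℝ) ^ 2)⁻¹) :=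
              mul_le_mul_of_nonneg_right h1 hPi0
          _ ≤ (rexp eulerMascheroniConstant * A * rexp E) * rexp (-S) :=
              mul_le_mul_of_nonneg_left h2 (by positivity)
    _ = rexp eulerMascheroniConstant * (A * rexp (E - S)) := by
        rw [Real.exp_sub, Real.exp_neg]; ring
    _ < rexp eulerMascheroniConstant * Real.log R :=
        mul_lt_mul_of_pos_left h7 (Real.exp_pos _)

end RobinAnalyticSharp

end Literature.NumberTheory.LFunctions

end
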